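import Summits.Ventures.PercRepro.Night2TwoOneGeneralStructure
import Summits.Ventures.PercRepro.Night2TwoOneFreeFaces

/-!
# PercRepro — the cell `(2, 1)` with two fat closures, ANY number of fat closures: the big-face losses and the
structure of a loaded target (night-2, gen 28)

`Night2TwoOneGeneralStructure` without the hypothesis «at most two fat closures»: every face requests `≤ 7/24`, so a
lossy big covering set has `L1 ≤ 3 · 7/24 = 7/8` and its big-face losses sum to at most `7/8 − 11/18 = 19/72`
(**`faceLossP_sum_le_free`**, **`structure_free`**).
-/

namespace PercRepro.Shadow

open Finset PerFlat ThmH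

variable {α : Type*} [DecidableEq α] {M : Matroid α} [M.Finite]

section FreeStructure

variable {G : Finset α}

open scoped Classical in
/-- **THE STRUCTURE OF A SET WITH A LOSSY BIG FACE, ANY NUMBER OF FAT CLOSURES** (two fat closures with
disjoint missed pairs): it meets each class once, `K ⊆ Q ⊆ G`, `Q ∖ K` has rank `5` and `≥ 6` points, the plane part
has rank `≥ 3` and `≥ 4` points, `|G ∖ Q| ≥ 4`, and `L1 Q ≤ 49/60`. -/
theorem structure_free (hG : G ∈ flatsQ M (5 + 1)) (hd : (gr M \ G).card = 2)
    (hk : kColoops M G = 1) (hs : ∀ e ∈ gr M, ∀ f ∈ gr M, e ≠ f → rkN M {e, f} = 2)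
    {B₀ B₁ : Finset α} (hB₀ : B₀ ∈ thinMembers M 5 G) (hB₁ : B₁ ∈ thinMembers M 5 G)
    (hm₀ : (G \ clF M B₀).card ≤ 2) (hm₁ : (G \ clF M B₁).card ≤ 2)
    (hdisj : Disjoint (G \ clF M B₀) (G \ clF M B₁)) {Q : Finset α}
    (hQ : ∃ w ∈ Q, faceLossP M 5 G (fun B => 5 ≤ (B \ coloops M G).card) Q w ≠ 0) :
    ∃ u u', u ≠ u' ∧ Q ∩ (G \ clF M B₀) = {u} ∧ Q ∩ (G \ clF M B₁) = {u'} ∧ Q ⊆ G ∧ coloops M G ⊆ Q ∧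
      rkN M (Q \ coloops M G) = 5 ∧ 6 ≤ (Q \ coloops M G).card ∧
      3 ≤ rkN M (Q ∩ ((clF M B₀ ∩ clF M B₁) \ coloops M G)) ∧
      4 ≤ (Q ∩ ((clF M B₀ ∩ clF M B₁) \ coloops M G)).card ∧ 4 ≤ (G \ Q).card ∧
      L1 M 5 G Q ≤ 7 / 8 := by
  have hd' : (gr M \ G).card ≤ 5 := by omega
  obtain ⟨w₀, hw₀, hne0⟩ := hQ
  have hcond : Q.erase w₀ ∈ thinMembers M 5 G ∧ 5 ≤ (Q.erase w₀ \ coloops M G).card ∧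
      w₀ ∈ G \ clF M (Q.erase w₀) := by
    unfold faceLossP at hne0
    by_contra h
    rw [if_neg h] at hne0
    exact hne0 rfl
  have hloss : loss M 5 G (Q.erase w₀) w₀ ≠ 0 := by
    unfold faceLossP at hne0
    rwa [if_pos hcond] at hne0
  have hQeq : insert w₀ (Q.erase w₀) = Q := Finset.insert_erase hw₀
  obtain ⟨B, hB⟩ : ∃ B, B = Q.erase w₀ := ⟨_, rfl⟩
  rw [← hB] at hcond hloss hQeq
  have hBU : B ∈ Uq M (5 + 2) 5 := (mem_membersIn.1 (mem_thinMembers.1 hcond.1).1).1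
  have hBG : B ⊆ G := (subset_clF hBU).trans (mem_membersIn.1 (mem_thinMembers.1 hcond.1).1).2
  have hKB : coloops M G ⊆ B := coloops_subset_of_mem_thinMembers hG hd' hcond.1
  have hQG : Q ⊆ G := by rw [← hQeq]; exact Finset.insert_subset (Finset.mem_sdiff.1 hcond.2.2).1 hBG
  have hKQ : coloops M G ⊆ Q := by rw [← hQeq]; exact hKB.trans (Finset.subset_insert _ _)
  have hQK5 : rkN M (Q \ coloops M G) = 5 := by
    rw [← hQeq]; exact rkN_insert_sdiff_coloops_eq_five_of_thin hG hd hk hcond.1 hcond.2.2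
  have hw₀B : w₀ ∉ B := notMem_of_notMem_clF hBU (Finset.mem_sdiff.1 hcond.2.2).2
  have hw₀K : w₀ ∉ coloops M G := fun h => hw₀B (hKB h)
  have hQKcard : 6 ≤ (Q \ coloops M G).card := by
    rw [← hQeq, Finset.insert_sdiff_of_notMem _ hw₀K, Finset.card_insert_of_notMem
      (fun h => hw₀B (Finset.mem_sdiff.1 h).1)]
    omega
  obtain ⟨u, u', h₀, h₁⟩ := one_per_class_free hG hd hk hB₀ hB₁ hm₀ hm₁ hcond.1
    hcond.2.2 hloss
  rw [hQeq] at h₀ h₁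
  have huu' : u ≠ u' := by
    intro h
    have hu : u ∈ Q ∩ (G \ clF M B₀) := by rw [h₀]; exact Finset.mem_singleton_self _
    have hu' : u' ∈ Q ∩ (G \ clF M B₁) := by rw [h₁]; exact Finset.mem_singleton_self _
    rw [← h] at hu'
    exact Finset.disjoint_left.1 hdisj (Finset.mem_inter.1 hu).2 (Finset.mem_inter.1 hu').2
  obtain ⟨hP3, hP4⟩ := plane_part_of_one_per_class hQG hQK5 hQKcard huu' h₀ h₁
  refine ⟨u, u', huu', h₀, h₁, hQG, hKQ, hQK5, hQKcard, hP3, hP4, ?_, ?_⟩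
  · -- the complement of the thin face `B = Q ∖ w₀` spans: `|G ∖ Q| + 1 ≥ 5`
    have h5 := five_le_rkN_sdiff_of_mem_Uq_two hG hd hBU hBG
    have hsub : G \ B ⊆ insert w₀ (G \ Q) := by
      intro x hx
      rw [Finset.mem_sdiff] at hx
      rw [Finset.mem_insert, Finset.mem_sdiff]
      by_cases hxw : x = w₀
      · exact Or.inl hxw
      · right
        refine ⟨hx.1, fun hxQ => hx.2 ?_⟩
        rw [← hQeq, Finset.mem_insert] at hxQ
        rcases hxQ with h | h
        · exact absurd h hxw
        · exact h
    have h1 := rkN_mono (M := M) hsub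
    have h2 := rkN_le_card (M := M) (insert w₀ (G \ Q))
    have h3 := Finset.card_insert_le w₀ (G \ Q)
    omega
  · have huQ : u ∈ Q ∩ (G \ clF M B₀) := by rw [h₀]; exact Finset.mem_singleton_self _
    have hu'Q : u' ∈ Q ∩ (G \ clF M B₁) := by rw [h₁]; exact Finset.mem_singleton_self _
    have hL1 := L1_le_of_spanning_free hG hd hk hs hB₀ hB₁ hdisj hQG hP3 hP4 huQ hu'Q
    have hWX : ((Q ∩ ((G \ clF M B₀) ∪ (G \ clF M B₁))).filter
        (fun w => Q.erase w ∈ thinMembers M 5 G)).card ≤ 2 := by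
      refine (Finset.card_le_card (Finset.filter_subset _ _)).trans ?_
      rw [Finset.inter_union_distrib_left, h₀, h₁]
      exact Finset.card_le_two
    have hWX' : (((Q ∩ ((G \ clF M B₀) ∪ (G \ clF M B₁))).filter
        (fun w => Q.erase w ∈ thinMembers M 5 G)).card : ℚ) ≤ 2 := by exact_mod_cast hWX
    nlinarith

open scoped Classical in
/-- **THE BIG-FACE LOSSES OF ANY SET SUM TO AT MOST `19/72`** (two fat closures with disjoint missed pairs, any
number of fat closures). -/
theorem faceLossP_sum_le_free (hG : G ∈ flatsQ M (5 + 1)) (hd : (gr M \ G).card = 2)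
    (hk : kColoops M G = 1) (hs : ∀ e ∈ gr M, ∀ f ∈ gr M, e ≠ f → rkN M {e, f} = 2)
    {B₀ B₁ : Finset α} (hB₀ : B₀ ∈ thinMembers M 5 G) (hB₁ : B₁ ∈ thinMembers M 5 G)
    (hm₀ : (G \ clF M B₀).card ≤ 2) (hm₁ : (G \ clF M B₁).card ≤ 2)
    (hdisj : Disjoint (G \ clF M B₀) (G \ clF M B₁)) (Q : Finset α) :
    ∑ w ∈ Q, faceLossP M 5 G (fun B => 5 ≤ (B \ coloops M G).card) Q w ≤ 19 / 72 := by
  have hd' : (gr M \ G).card ≤ 5 := by omega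
  by_cases hex : ∃ w ∈ Q, faceLossP M 5 G (fun B => 5 ≤ (B \ coloops M G).card) Q w ≠ 0
  · obtain ⟨-, -, -, -, -, hQG, -, -, -, -, -, -, hL1⟩ :=
      structure_free hG hd hk hs hB₀ hB₁ hm₀ hm₁ hdisj hex
    obtain ⟨w₀, hw₀, hne0⟩ := hex
    have hcond : Q.erase w₀ ∈ thinMembers M 5 G ∧ 5 ≤ (Q.erase w₀ \ coloops M G).card ∧
        w₀ ∈ G \ clF M (Q.erase w₀) := by
      unfold faceLossP at hne0
      by_contra h
      rw [if_neg h] at hne0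
      exact hne0 rfl
    have hloss : loss M 5 G (Q.erase w₀) w₀ ≠ 0 := by
      unfold faceLossP at hne0
      rwa [if_pos hcond] at hne0
    have hQeq : insert w₀ (Q.erase w₀) = Q := Finset.insert_erase hw₀
    have hcap := capS_ge_eleven_eighteenths_two_one hd hk hQG
    have hsat : capS M 5 G Q < L1 M 5 G Q := by
      by_contra h
      push Not at h
      apply hloss
      unfold loss fS
      rw [hQeq, if_pos h]
      ring
    have hzeroK : ∀ w ∈ Q, w ∈ coloops M G →
        faceLossP M 5 G (fun B => 5 ≤ (B \ coloops M G).card) Q w = 0 := by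
      intro w _ hwK
      unfold faceLossP
      rw [if_neg]
      rintro ⟨hthin, -, -⟩
      have := coloops_subset_of_mem_thinMembers hG hd' hthin hwK
      exact (Finset.notMem_erase w Q) this
    have hsum : ∑ w ∈ Q, faceLossP M 5 G (fun B => 5 ≤ (B \ coloops M G).card) Q w =
        ∑ w ∈ Q \ coloops M G, faceLossP M 5 G (fun B => 5 ≤ (B \ coloops M G).card) Q w := by
      symm
      apply Finset.sum_subset Finset.sdiff_subset
      intro w hw hwn
      have hwK : w ∈ coloops M G := by
        by_contra h
        exact hwn (Finset.mem_sdiff.2 ⟨hw, h⟩)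
      exact hzeroK w hw hwK
    have hle := Finset.sum_le_sum (fun w (_ : w ∈ Q \ coloops M G) =>
      faceLossP_le_faceLoss (P := fun B => 5 ≤ (B \ coloops M G).card) hG hd' Q w)
    have hL := sum_faceLoss_le_L1_mul hG hd' Q
    have hfS : fS M 5 G Q = capS M 5 G Q / L1 M 5 G Q := by
      unfold fS
      rw [if_neg (not_le.2 hsat)]
    have hL1pos : 0 < L1 M 5 G Q := by linarith
    have hexc : L1 M 5 G Q * (1 - fS M 5 G Q) = L1 M 5 G Q - capS M 5 G Q := by
      rw [hfS]; field_simp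
    rw [hsum]
    linarith
  · push Not at hex
    rw [Finset.sum_eq_zero hex]
    norm_num

end FreeStructure

end PercRepro.Shadow
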